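import Mathlib.Topology.Separation.Hausdorff
import Mathlib.Topology.Compactness.Compact
import HarnessLib

/-!
# Levelwise membership in a compact set of families is membership: if `β` agrees, on every initial segment of levels, with SOME member of a
# compact set `A ⊆ Π m, X m`, then `β ∈ A` (Cantor intersection) — the «levelwise-to-limit» principle for closed subgroups of `lim←`

Topic `Algebra/InverseSystem`; namespace `Literature.Algebra.InverseSystem`.  For a tower of Hausdorff spaces `X m` and a COMPACT set
`A` of families (product topology), a family `β` such that for every `n` some `α ∈ A` has `α m = β m` for all `m ≤ n` lies in `A`: the sets
`A_n = {α ∈ A | α|_{≤ n} = β|_{≤ n}}` are closed, non-empty and decreasing, so they have a common point, which is `β`.  In the tree this is how a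
norm-coherent family of local units whose every finite-level component is the component of SOME element of a closed subgroup `A` of the compact
group `U¹_∞(𝔓)` is shown to lie in `A` (de Shalit III §1.3–1.4: the closures `C̄_n` and `lim← C̄_n`; for compatible families agreement at level `n`
forces agreement below `n`).  THEOREMS ONLY (no definition, no named fact, no `sorry`).

* ★★ `mem_of_forall_exists_mem_forall_le_eq` — the principle above;
* `mem_of_forall_exists_mem_apply_eq` — the form with agreement at the single level `n` when agreement propagates downwards (compatible families).

## References
* [deShalit1987] E. de Shalit, *Iwasawa theory of elliptic curves with complex multiplication* (1987), Ch. III §1.3–1.4 (p. 88–91).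
* [Weibel1994] C. A. Weibel, *An introduction to homological algebra* (1994), §3.5 (towers, `lim←`).
-/

namespace Literature.Algebra.InverseSystem

section Levelwise

variable {X : ℕ → Type*} [∀ m, TopologicalSpace (X m)] [∀ m, T2Space (X m)]

/-- ★★ **Levelwise membership in a compact set of families is membership**: `A ⊆ Π m, X m` compact, and for every `n` some `α ∈ A` agrees with `β` at
all levels `m ≤ n` ⟹ `β ∈ A`. [cite: deShalit1987, Ch. III §1.4 (p. 90–91)] [cite: Weibel1994, §3.5] -/
theorem mem_of_forall_exists_mem_forall_le_eq {A : Set (∀ m, X m)} (hA : IsCompact A) (β : ∀ m, X m)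
    (h : ∀ n : ℕ, ∃ α ∈ A, ∀ m ≤ n, α m = β m) : β ∈ A := by
  -- the closed, non-empty, decreasing pieces `A_n`
  let S : ℕ → Set (∀ m, X m) := fun n ↦ A ∩ {α | ∀ m ≤ n, α m = β m}
  have hcl : ∀ n, IsClosed {α : ∀ m, X m | ∀ m ≤ n, α m = β m} := by
    intro n
    have e : {α : ∀ m, X m | ∀ m ≤ n, α m = β m} = ⋂ m ∈ {m | m ≤ n}, (fun α : ∀ m, X m ↦ α m) ⁻¹' {β m} := by
      ext α; simp
    rw [e]
    exact isClosed_biInter fun m _ ↦ isClosed_singleton.preimage (continuous_apply m)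
  have hSc : ∀ n, IsCompact (S n) := fun n ↦ hA.inter_right (hcl n)
  have hSne : ∀ n, (S n).Nonempty := fun n ↦ by
    obtain ⟨α, hα, hαβ⟩ := h n
    exact ⟨α, hα, hαβ⟩
  have hmono : ∀ n, S (n + 1) ⊆ S n := fun n α hα ↦ ⟨hα.1, fun m hm ↦ hα.2 m (Nat.le_succ_of_le hm)⟩
  have hanti : Antitone S := antitone_nat_of_succ_le hmono
  have hdir : Directed (· ⊇ ·) S := hanti.directed_ge
  obtain ⟨α, hα⟩ := IsCompact.nonempty_iInter_of_directed_nonempty_isCompact_isClosed S hdir hSne hSc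
    (fun n ↦ hA.isClosed.inter (hcl n)) |>.imp fun α hα ↦ Set.mem_iInter.mp hα
  have hαβ : α = β := funext fun m ↦ (hα m).2 m le_rfl
  exact hαβ ▸ (hα 0).1

/-- The same when agreement at level `n` alone is available but propagates to the lower levels (e.g. `β` and the members of `A` are compatible families
of a tower, so `α n = β n ⟹ α m = β m` for `m ≤ n`). [cite: deShalit1987, Ch. III §1.4 (p. 90–91)] -/
theorem mem_of_forall_exists_mem_apply_eq {A : Set (∀ m, X m)} (hA : IsCompact A) (β : ∀ m, X m)
    (hdown : ∀ α ∈ A, ∀ n, α n = β n → ∀ m ≤ n, α m = β m)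
    (h : ∀ n : ℕ, ∃ α ∈ A, α n = β n) : β ∈ A :=
  mem_of_forall_exists_mem_forall_le_eq hA β fun n ↦ by
    obtain ⟨α, hα, hn⟩ := h n
    exact ⟨α, hα, hdown α hα n hn⟩

end Levelwise

end Literature.Algebra.InverseSystem
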